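import Summits.QuantumFields.YangMills.Theorems.BalabanUVNodesN19ContinuumLaw
import Summits.QuantumFields.YangMills.Theorems.BalabanUVNodesN19TargetEverySource

/-!
# BalabanUVNodes ∕ N19 (NE7 proper) — THE CONTINUUM LAW OF ONE STRING OBSERVABLE: under N19's DECL target on ANY source window the LAWS
# `gibbs_K.map (∏os)` converge WEAKLY to a UNIQUE probability law `ν` on `[−1, 1]`; the continuum expectation is its mean, the continuum generating
# function is `cgf id ν` at every real source, the limit of the complex MGFs is `ν`'s Fourier–Laplace transform, and at every source `s` the
# source-tilted laws converge to the exponential tilt `ν.tilted (s·)`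

Cell `pub-ymgap` (HUMAN RULING D-0062, Track A), R141 (C) WIDER STRATEGY seat `pub-ymgap-dag-n19-e` (strategy s3 «alternative currency»), gen 9, second
module (at-scheme half); filed `--kind proof --supports` K3⁗ `SpineGivenEndpointR13Sep` = stmt-QuantumFields-20292 `--as helper` (route rev 19).
COUNT-NEUTRAL.  THEOREMS ONLY (0 `def`); imports the generic sibling `…N19ContinuumLaw` (this seat, gen 9) and this seat's `…N19TargetEverySource`
(p501027: E3's hypothesis at the scheme under `Target`, `tendsto_cgf_gibbs_of_target`); edits nothing.

WHAT THIS IS [bookkeeping].  The generic continuum-law theorems read at the torus scheme `S` for ONE string `os` under N19's DECL target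
`Spine.NE7.Target vol l₀ δ (schemeZ S os)` on ANY window `l₀ > 0`: ★★ `exists_continuumLaw_of_target` (a probability law `ν` on `[−1, 1]` with
`∫ f(∏os) d gibbs_K → ∫ f dν` for every continuous `f`), ★ `tendsto_law_prodObs_of_continuumLaw` (weak convergence of `gibbs_K.map (∏os)` in
`ProbabilityMeasure ℝ`), `continuumLaw_unique`, `tendsto_expectAt_of_continuumLaw` (the continuum expectation of `…N19ExpectationCurrency` ∕
`…TwoConstantsRate` IS the mean of `ν`), `genFunLim_eq_cgf_of_continuumLaw` (the continuum generating function IS `cgf id ν` at EVERY real source),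
`tendsto_complexMGF_prodObs_of_continuumLaw` (the entire limit of the complex MGFs — sibling `…N19ContinuumGenFunAnalytic`, p502271 — IS `z ↦ ∫ e^{zx} dν`),
`tendsto_sourcedIntegral_of_continuumLaw` (the continuum law under the source `s` — the sourced response of `…N19SourcedResponse` — is `ν.tilted (s·)`),
assembled in ★ `continuumLaw_of_target`.

HONEST CAVEAT (binding).  For ONE bounded observable, `Target` ⇒ «all moments converge» is ALREADY the tree's node E3 (p501027's wording); the news is only
the NAMED limit law with weak convergence, uniqueness and the mean ∕ cgf ∕ transform ∕ tilt identifications — [folklore] BY NAME, no estimate, no rate (rates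
live in the siblings, inside the window).  `Target` is a HYPOTHESIS (NE7 NOT PRINTED as a two-run statement for d = 4, NOT proved); nothing of Bałaban's is
instantiated; N19 NOT discharged (0∕1); K3⁗ NOT claimed; counts UNMOVED (5∕27).  One finite four-torus programme at fixed `ε` (the `K → ∞` cut-off limit of
ONE string's law on ONE torus) — NOT ℝ⁴, NOT infinite volume, NOT OS, NOT a mass gap, NOT Clay.  0 `def`; 0 `sorry`; standard axioms; no cite tags.
-/

noncomputable section

open Set Filter Topology MeasureTheory ProbabilityTheory

namespace Summit.QuantumFields.YangMills.BalabanUVNodes.N19ContinuumLawAtScheme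

open Literature.MathematicalPhysics.QuantumFieldTheory.Balaban1983to89
open Summit.QuantumFields.YangMills.BalabanUVNodes.N19ContinuumLaw

/-! ## At the torus scheme under N19's DECL target on ANY window: the continuum law of ONE string observable [bookkeeping] -/

section Scheme

open T4CauchySum (genFun genFunLim)
open T4GenFunBounds (schemeZ prodObs gibbsMeasure)
open Missing (TorusScheme)
open Summit.QuantumFields.BalabanUV.T4Continuum.Spine
open Summit.QuantumFields.YangMills.BalabanUVNodes.N19TargetEverySource (tendsto_cgf_gibbs_of_target)

variable {G : Type*} [GaugeGroup G] [MeasurableSpace G] [RegularGaugeGroup G] [HaarData G] {O : Type*}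
  (S : TorusScheme G O) (hβ : ∀ K, 0 ≤ S.β K) (hm : ∀ K o, Measurable (S.obs K o))
  (h1 : ∀ K o U, |S.obs K o U| ≤ 1)
include hβ hm h1

/-- ★★ **THE CONTINUUM LAW OF ONE STRING OBSERVABLE EXISTS UNDER `Target`**: if `Spine.NE7.Target vol l₀ δ (schemeZ S os)` holds on some window
`l₀ > 0` (a HYPOTHESIS), there is a probability measure `ν` on `ℝ` carried by `[−1, 1]` with `∫ f(∏os) d gibbs_K → ∫ f dν` for EVERY continuous `f`
(E3 at the scheme, p501027, + the generic sibling `exists_lawLimit_of_tendsto_cgf`). -/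
theorem exists_continuumLaw_of_target {vol l₀ : ℝ} {δ : ℕ → ℝ} (hl₀ : 0 < l₀) (os : List O)
    (hT : NE7.Target vol l₀ δ (schemeZ S os)) :
    ∃ ν : Measure ℝ, IsProbabilityMeasure ν ∧ ν (Icc (-1) 1)ᶜ = 0 ∧
      ∀ f : ℝ → ℝ, Continuous f →
        Tendsto (fun K => ∫ U, f (prodObs S K os U) ∂gibbsMeasure (S.P K) (S.β K)) atTop (𝓝 (∫ x, f x ∂ν)) := by
  haveI hP : ∀ K, IsProbabilityMeasure (gibbsMeasure (G := G) (S.P K) (S.β K)) := fun K =>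
    T4GenFunBounds.isProbabilityMeasure_gibbsMeasure (G := G) (S.P K) (hβ K)
  exact exists_lawLimit_of_tendsto_cgf (μ := fun K => gibbsMeasure (S.P K) (S.β K)) (X := fun K => prodObs S K os)
    (fun K => (T4GenFunBounds.measurable_prodObs S hm K os).aemeasurable)
    (fun K => T4GenFunBounds.abs_prodObs_le_one S h1 K os) hl₀ (tendsto_cgf_gibbs_of_target S hβ hm h1 hl₀ os hT)

omit h1 in
/-- ★ **WEAK CONVERGENCE OF THE LAWS OF `∏os`**: a continuum law `ν` (receiving the limits of all continuous observables of `∏os`) is the limit of the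
laws `gibbs_K.map (∏os)` in `ProbabilityMeasure ℝ`. -/
theorem tendsto_law_prodObs_of_continuumLaw (os : List O) (ν : ProbabilityMeasure ℝ)
    (hν : ∀ f : ℝ → ℝ, Continuous f →
      Tendsto (fun K => ∫ U, f (prodObs S K os U) ∂gibbsMeasure (S.P K) (S.β K)) atTop (𝓝 (∫ x, f x ∂(ν : Measure ℝ)))) :
    Tendsto (β := ProbabilityMeasure ℝ) (fun K => ⟨(gibbsMeasure (S.P K) (S.β K)).map (prodObs S K os),
        haveI := T4GenFunBounds.isProbabilityMeasure_gibbsMeasure (G := G) (S.P K) (hβ K)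
        Measure.isProbabilityMeasure_map (T4GenFunBounds.measurable_prodObs S hm K os).aemeasurable⟩)
      atTop (𝓝 ν) := by
  haveI hP : ∀ K, IsProbabilityMeasure (gibbsMeasure (G := G) (S.P K) (S.β K)) := fun K =>
    T4GenFunBounds.isProbabilityMeasure_gibbsMeasure (G := G) (S.P K) (hβ K)
  exact tendsto_law_of_lawLimit (μ := fun K => gibbsMeasure (S.P K) (S.β K)) (X := fun K => prodObs S K os)
    (fun K => (T4GenFunBounds.measurable_prodObs S hm K os).aemeasurable) ν hν

omit [RegularGaugeGroup G] hβ hm h1 in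
/-- **THE CONTINUUM LAW OF `∏os` IS UNIQUE** (bounded continuous functions separate finite Borel measures on `ℝ`). -/
theorem continuumLaw_unique (os : List O) (ν₁ ν₂ : Measure ℝ) [IsProbabilityMeasure ν₁] [IsProbabilityMeasure ν₂]
    (h₁ : ∀ f : ℝ → ℝ, Continuous f →
      Tendsto (fun K => ∫ U, f (prodObs S K os U) ∂gibbsMeasure (S.P K) (S.β K)) atTop (𝓝 (∫ x, f x ∂ν₁)))
    (h₂ : ∀ f : ℝ → ℝ, Continuous f →
      Tendsto (fun K => ∫ U, f (prodObs S K os U) ∂gibbsMeasure (S.P K) (S.β K)) atTop (𝓝 (∫ x, f x ∂ν₂))) : ν₁ = ν₂ :=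
  lawLimit_unique (μ := fun K => gibbsMeasure (S.P K) (S.β K)) (X := fun K => prodObs S K os) ν₁ ν₂ h₁ h₂

omit hm h1 in
/-- **THE CONTINUUM EXPECTATION IS THE MEAN OF THE CONTINUUM LAW**: `S.expectAt K os → ∫ x dν` (the limit of `…N19ExpectationCurrency` ∕ `…TwoConstantsRate`,
there with rates inside the window, is `ν`'s first moment). -/
theorem tendsto_expectAt_of_continuumLaw (os : List O) (ν : Measure ℝ)
    (hν : ∀ f : ℝ → ℝ, Continuous f →
      Tendsto (fun K => ∫ U, f (prodObs S K os U) ∂gibbsMeasure (S.P K) (S.β K)) atTop (𝓝 (∫ x, f x ∂ν))) :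
    Tendsto (fun K => S.expectAt K os) atTop (𝓝 (∫ x, x ∂ν)) :=
  (hν (fun x => x) continuous_id).congr fun K => (T4GenFunBounds.expectAt_eq_integral_gibbs S hβ K os).symm

/-- **THE CONTINUUM GENERATING FUNCTION IS THE CGF OF THE CONTINUUM LAW AT EVERY REAL SOURCE**: `genFun (schemeZ S os) K t → cgf id ν t` and
`genFunLim (schemeZ S os) t = cgf id ν t` for every `t ∈ ℝ` (window or not). -/
theorem genFunLim_eq_cgf_of_continuumLaw (os : List O) (ν : Measure ℝ)
    (hν : ∀ f : ℝ → ℝ, Continuous f →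
      Tendsto (fun K => ∫ U, f (prodObs S K os U) ∂gibbsMeasure (S.P K) (S.β K)) atTop (𝓝 (∫ x, f x ∂ν))) (t : ℝ) :
    Tendsto (fun K => genFun (schemeZ S os) K t) atTop (𝓝 (cgf id ν t)) ∧ genFunLim (schemeZ S os) t = cgf id ν t := by
  haveI hP : ∀ K, IsProbabilityMeasure (gibbsMeasure (G := G) (S.P K) (S.β K)) := fun K =>
    T4GenFunBounds.isProbabilityMeasure_gibbsMeasure (G := G) (S.P K) (hβ K)
  have h := (tendsto_cgf_of_lawLimit (μ := fun K => gibbsMeasure (S.P K) (S.β K)) (X := fun K => prodObs S K os)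
    (fun K => (T4GenFunBounds.measurable_prodObs S hm K os).aemeasurable)
    (fun K => T4GenFunBounds.abs_prodObs_le_one S h1 K os) ν hν t).2
  have h' : Tendsto (fun K => genFun (schemeZ S os) K t) atTop (𝓝 (cgf id ν t)) :=
    h.congr fun K => (T4GenFunBounds.genFun_schemeZ_eq_cgf S hβ hm h1 K os t).symm
  exact ⟨h', h'.limUnder_eq⟩

/-- **THE LIMIT OF THE COMPLEX MGFs IS THE FOURIER–LAPLACE TRANSFORM OF THE CONTINUUM LAW**: for every `z ∈ ℂ`,
`∫ e^{z∏os} d gibbs_K → ∫ e^{zx} dν(x)` — the entire limit function of the sibling `…N19ContinuumGenFunAnalytic` is `complexMGF id ν`. -/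
theorem tendsto_complexMGF_prodObs_of_continuumLaw (os : List O) (ν : Measure ℝ) [IsProbabilityMeasure ν] (hν1 : ν (Icc (-1) 1)ᶜ = 0)
    (hν : ∀ f : ℝ → ℝ, Continuous f →
      Tendsto (fun K => ∫ U, f (prodObs S K os U) ∂gibbsMeasure (S.P K) (S.β K)) atTop (𝓝 (∫ x, f x ∂ν))) (z : ℂ) :
    Tendsto (fun K => complexMGF (prodObs S K os) (gibbsMeasure (S.P K) (S.β K)) z) atTop (𝓝 (complexMGF id ν z)) := by
  haveI hP : ∀ K, IsProbabilityMeasure (gibbsMeasure (G := G) (S.P K) (S.β K)) := fun K =>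
    T4GenFunBounds.isProbabilityMeasure_gibbsMeasure (G := G) (S.P K) (hβ K)
  exact tendsto_complexMGF_of_lawLimit (μ := fun K => gibbsMeasure (S.P K) (S.β K)) (X := fun K => prodObs S K os)
    (fun K => (T4GenFunBounds.measurable_prodObs S hm K os).aemeasurable)
    (fun K => T4GenFunBounds.abs_prodObs_le_one S h1 K os) ν hν1 hν z

/-- **THE CONTINUUM LAW UNDER A SOURCE IS THE TILTED CONTINUUM LAW**: for every source `s` and continuous `f`, the `s·∏os`-tilted Gibbs expectations of
`f(∏os)` converge to `∫ f d(ν.tilted (s·))` — the sourced response curve of `…N19SourcedResponse` is the mean of the tilts of ONE law. -/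
theorem tendsto_sourcedIntegral_of_continuumLaw (os : List O) (ν : Measure ℝ)
    (hν : ∀ f : ℝ → ℝ, Continuous f →
      Tendsto (fun K => ∫ U, f (prodObs S K os U) ∂gibbsMeasure (S.P K) (S.β K)) atTop (𝓝 (∫ x, f x ∂ν))) (s : ℝ) {f : ℝ → ℝ}
    (hf : Continuous f) :
    Tendsto (fun K => ∫ U, f (prodObs S K os U) ∂(gibbsMeasure (S.P K) (S.β K)).tilted (fun U => s * prodObs S K os U)) atTop
      (𝓝 (∫ x, f x ∂ν.tilted (fun x => s * x))) := by
  haveI hP : ∀ K, IsProbabilityMeasure (gibbsMeasure (G := G) (S.P K) (S.β K)) := fun K =>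
    T4GenFunBounds.isProbabilityMeasure_gibbsMeasure (G := G) (S.P K) (hβ K)
  exact tendsto_integral_comp_tilted_of_lawLimit (μ := fun K => gibbsMeasure (S.P K) (S.β K)) (X := fun K => prodObs S K os)
    (fun K => (T4GenFunBounds.measurable_prodObs S hm K os).aemeasurable)
    (fun K => T4GenFunBounds.abs_prodObs_le_one S h1 K os) ν hν s hf

/-- ★ **ASSEMBLY UNDER `Target`** (a HYPOTHESIS; NE7 NOT PRINTED ∕ NOT proved): ONE probability law `ν` on `[−1, 1]` such that every continuous observable of
`∏os` converges to its `ν`-integral, the string's expectations converge to its mean, the continuum generating function is its cgf at every real source,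
and any other law with the first property equals `ν`.  N19 NOT discharged; count-neutral. -/
theorem continuumLaw_of_target {vol l₀ : ℝ} {δ : ℕ → ℝ} (hl₀ : 0 < l₀) (os : List O) (hT : NE7.Target vol l₀ δ (schemeZ S os)) :
    ∃ ν : Measure ℝ, IsProbabilityMeasure ν ∧ ν (Icc (-1) 1)ᶜ = 0 ∧
      (∀ f : ℝ → ℝ, Continuous f →
        Tendsto (fun K => ∫ U, f (prodObs S K os U) ∂gibbsMeasure (S.P K) (S.β K)) atTop (𝓝 (∫ x, f x ∂ν))) ∧
      Tendsto (fun K => S.expectAt K os) atTop (𝓝 (∫ x, x ∂ν)) ∧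
      (∀ t : ℝ, genFunLim (schemeZ S os) t = cgf id ν t) ∧
      ∀ ν' : Measure ℝ, IsProbabilityMeasure ν' →
        (∀ f : ℝ → ℝ, Continuous f →
          Tendsto (fun K => ∫ U, f (prodObs S K os U) ∂gibbsMeasure (S.P K) (S.β K)) atTop (𝓝 (∫ x, f x ∂ν'))) → ν' = ν := by
  obtain ⟨ν, hν, hν1, hlim⟩ := exists_continuumLaw_of_target S hβ hm h1 hl₀ os hT
  exact ⟨ν, hν, hν1, hlim, tendsto_expectAt_of_continuumLaw S hβ os ν hlim,
    fun t => (genFunLim_eq_cgf_of_continuumLaw S hβ hm h1 os ν hlim t).2,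
    fun ν' hν' h' => continuumLaw_unique S os ν' ν h' hlim⟩

end Scheme

end Summit.QuantumFields.YangMills.BalabanUVNodes.N19ContinuumLawAtScheme
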